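import Mathlib
import Literature.Combinatorics.Additive.TripleProductProperty
import Literature.Computability.AlgebraicComplexity.GroupTheoreticMatMul
import Literature.Computability.AlgebraicComplexity.GroupTheoreticMatMulThmBProofs
import Summits.MatrixMultiplication.MatrixMultiplication.Theorems.AutomaticSTPPDesignsAutomaticPackingThesisStubConcatSTPP

/-!
# Concatenation powers with product block sizes — stub `stub_powFamily` of line `Sketch`
(crux `AutomaticPackingThesis`, stmt-MatrixMultiplication-7356)

An STPP design `(A, B, C)` in the cyclic group `ℤ/p^K`, indexed by `Fin n`, has for every `m` an
explicit `m`-th concatenation power: an STPP family in `ℤ/p^(K m)` indexed by WORDS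
`w : Fin m → Fin n` whose blocks have the product sizes `|A_w| = Π_t |A (w t)|` (likewise for `B`,
`C`). This is CKSU 2005, Lemma 5.4 iterated inside one cyclic `p`-tower: induction on `m`, the
step concatenating the `m`-th power (low digits) with the design itself (high digits) by
`stub_concatSTPP` and reindexing the product-indexed family along the injection
`w ↦ (w ∘ Fin.castSucc, w (Fin.last m))`; block sizes multiply (`card_concat`), and
`K * (m + 1) = K * m + K` holds definitionally.
-/

set_option linter.dupNamespace false
-- (single-conjunct summit: the namespace repeats `MatrixMultiplication`)

namespace Summit.MatrixMultiplication.MatrixMultiplication.Theorems.AutomaticPackingThesis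

open Finset Literature.Combinatorics.Additive Literature.Computability.AlgebraicComplexity

/-- **Concatenation powers with product block sizes** (registered stub `stub_powFamily` of line
`Sketch`): an STPP design in `ℤ/p^K` indexed by `Fin n` has, for every `m`, an `m`-th
concatenation power indexed by words `w : Fin m → Fin n` — an STPP family in `ℤ/p^(K m)` whose
blocks have the product sizes `|A_w| = Π_t |A (w t)|`, `|B_w| = Π_t |B (w t)|`,
`|C_w| = Π_t |C (w t)|`. Induction on `m`: the empty word carries the singleton design `{0}` in
the trivial group `ℤ/p^0`; the step concatenates the `m`-th power with the design
(`stub_concatSTPP`, low digits first) and reindexes along the injection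
`w ↦ (w ∘ Fin.castSucc, w (Fin.last m))`, the block sizes multiplying by `card_concat` and
`Fin.prod_univ_castSucc`. [folklore] -/
theorem stub_powFamily (p K n : ℕ) (hp : 0 < p) (A B C : Fin n → Finset (ZMod (p ^ K)))
    (hS : IsSTPP A B C) (m : ℕ) :
    ∃ (Am Bm Cm : (Fin m → Fin n) → Finset (ZMod (p ^ (K * m)))),
      AddSimultaneousTPP Am Bm Cm ∧
      ∀ w, (Am w).card = ∏ t, (A (w t)).card ∧ (Bm w).card = ∏ t, (B (w t)).card ∧
        (Cm w).card = ∏ t, (C (w t)).card := by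
  induction m with
  | zero =>
    refine ⟨fun _ => {0}, fun _ => {0}, fun _ => {0}, ?_, fun w => ?_⟩
    · rw [addSimultaneousTPP_iff_forall]
      intro i j k s hs s' hs' t ht t' ht' u hu u' hu' _
      simp only [mem_singleton] at hs hs' ht ht' hu hu'
      exact ⟨Subsingleton.elim _ _, Subsingleton.elim _ _, by rw [hs, hs'], by rw [ht, ht'],
        by rw [hu, hu']⟩
    · simp only [card_singleton, univ_eq_empty, prod_empty, and_self]
  | succ m ih =>
    obtain ⟨Am, Bm, Cm, hSm, hcard⟩ := ih
    -- concatenate the `m`-th power (low digits) with the design itself (high digits)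
    have hcat := stub_concatSTPP p (K * m) K hp (Fin m → Fin n) (Fin n) Am Bm Cm A B C hSm
      ((isSTPP_iff_addSimultaneousTPP A B C).1 hS)
    -- reindex along the injection `w ↦ (w ∘ castSucc, w (last m))`
    have he : Function.Injective fun w : Fin (m + 1) → Fin n =>
        ((fun t : Fin m => w (Fin.castSucc t)), w (Fin.last m)) := by
      intro w w' h
      simp only [Prod.mk.injEq] at h
      funext t
      induction t using Fin.lastCases with
      | last => exact h.2
      | cast t => exact congr_fun h.1 t
    -- `K * (m + 1) = K * m + K`, so the concatenated family lives in the right group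
    rw [Nat.mul_succ]
    refine ⟨_, _, _, hcat.comp he, fun w => ?_⟩
    simp only [Function.comp_apply, card_concat p (K * m) K hp, hcard, Fin.prod_univ_castSucc,
      and_self]

end Summit.MatrixMultiplication.MatrixMultiplication.Theorems.AutomaticPackingThesis
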